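import Summits.RiemannHypothesis.RiemannHypothesis.Theses.RuelleBand
import Summits.RiemannHypothesis.RiemannHypothesis.Theorems.RuelleBandNribWeakRecurrenceToExactIff
import Summits.RiemannHypothesis.RiemannHypothesis.Theorems.RuelleBandLadderGlue
import Literature.NumberTheory.LFunctions.WeilExplicit
import Mathlib.Analysis.Calculus.BumpFunction.InnerProduct
import HarnessLib

/-!
# `RuelleBand.ZetaWeakRecurrence` — line `early-prime-resonance`
(crux stmt-RiemannHypothesis-18110, route route-RiemannHypothesis-RuelleBand; crux idea
`Cruxes/ZetaWeakRecurrence/Ideas/early-prime-resonance.md`, triage TRIAGE-r1-1/2: pass)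

WR (the crux): on every closed disc `|s − z| ≤ r` of the half-strip `1/2 < σ < 1`, for every `ε > 0` and
every height `T` some shift `τ ≥ T` has `max_{|s−z|≤r} |ζ(s+iτ) − ζ(s)| < ε`.

## The line in one paragraph
The TREND-FREE PRIME WAVE at log-scale `u` and frequency `T` through a smooth window `W` supported in
`[-1, 1]` is `D_W(u,T) := P(g) − ĝ(1)` for the Weil test `g(t) = W(t − u)·e^{−iTt}`, where
`P(g) = weilPrimeTerm g = Σ_n Λ(n) n^{−1/2−iT} W(log n − u)` (for `u > 1`) and `ĝ(1) = weilMellin g 1` is the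
polar trend. By the explicit formula (tree `explicit_formula_holds`, `explicit_formula_of_decay`)
`D_W(u,T) = ĝ(0) + W_∞(g) − Σ_ρ m(ρ) e^{(ρ−1/2−iT)u} Ŵ(ρ − 1/2 − iT)`, `Ŵ(w) = ∫ W(y)e^{wy}dy`: a zero `ρ` at
height distance `d` from `T` contributes `≍ e^{(Re ρ − 1/2)u}(1+d)^{−N}`.  Hence
(A) DICTIONARY `stub_earlyDeviationForcesZero` (provable): a deviation `|D_W(u,T)| ≥ c·e^{(β−1/2)u}` at an EARLY
    height (`log T ≤ κe^{εu}`, so that the `≍ log T` on-line zeros per unit height cannot fake it) forces a zero with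
    `Re ρ ≥ β − 2ε`, `|Im ρ − T| ≤ e^u`;
(B) ANOMALY `stub_topZeroForcesDeviation` (provable): a zero `ξ` of GLOBALLY maximal real part `Θ > 1/2` makes
    `|D_W(u, Im ξ)| ≥ c·e^{(Θ−1/2)u}` for an unbounded set of scales `u` (the normalised zero side is a uniformly
    almost periodic function of `u` with Bohr coefficient `m(ξ)Ŵ(Θ−1/2) ≠ 0` at frequency `0`; Cesàro mean);
(C) EARLY RETURN `stub_earlyReturnOfDeviation` (OPEN — the arithmetic heart, a statement about prime sums only):
    if the trend-free wave deviates by `c·e^{(β−1/2)u}` at one height `γ` for unboundedly many scales, then beyond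
    every height there are EARLY heights (`2e^u ≤ T`, `log T ≤ κe^{εu}`) with a comparable deviation
    `c'·e^{(β−ε−1/2)u}` ("the Kronecker flow `(p^{−iT})_p` returns early to the large-deviation set").
COMPOSITION (this file, sorry-free): under the ROUTE ITEM `AsymptoticCriticalLine` (crux #4, taken BY NAME as a
hypothesis — admissible obligation) an off-line zero `ξ₀` (`δ := Re ξ₀ − 1/2`) gives a global top zero `ξ`
(finitely many zeros right of `1/2 + δ/2`); (B) at `ξ`, (C), then (A) beget a zero with `Re ρ ≥ Re ξ − 3δ/16` at
height `> H`, where `H` bounds the heights of the FINITE set of zeros with `|Re s − 1/2| ≥ δ/2` — contradiction.  So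
`AsymptoticCriticalLine → ExactFirstBand` (`exactFirstBand_of_acl`), whence the crux BY NAME
(`ZetaWeakRecurrence_of`, via the landed calibration `zetaWeakRecurrence_of_exactFirstBand`) and, as corollaries,
the route's two open glue rungs `AsymptoticToCofinite`, `CofiniteToExact` by name.

HONEST LABEL.  Relative to ACL the line proves RH; its open content is (C) alone ((A),(B) are explicit-formula
theorems).  Why ACL and not the sibling crux NRIB: the lever is ONE-SIDED (a deviation forces a zero at least this
far right, never "exactly this far"), so it cannot exclude zeros marching to `Re s = 1`, which NRIB allows; ACL =
NRIB ∧ zero-free strip (tree `acl_iff_noRightInteriorBand_and_strip`) is the minimal route item that works.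

Dictionary (verbatim expansions, no local `def`):
* `g_{W,u,T}`  ↦ `fun t : ℝ => (W (t - u) : ℂ) * Complex.exp (-(T * t * Complex.I))`
* `D_W(u,T)`   ↦ `‖weilPrimeTerm g_{W,u,T} - weilMellin g_{W,u,T} 1‖`
* admissible `W` ↦ `ContDiff ℝ ∞ W`, `0 ≤ W`, `tsupport W ⊆ [-1,1]`, `W 0 = 1` (instantiated with a `ContDiffBump`).
-/

-- D-0017: single-problem summit; the lakefile turns this linter off for `Summits`; repeated here so that
-- standalone elaboration is warning-free as well.
set_option linter.dupNamespace false

noncomputable section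

open Complex Set Metric Filter Topology MeasureTheory
open scoped ContDiff

namespace Summit.RiemannHypothesis.RiemannHypothesis.Cruxes.ZetaWeakRecurrence.EarlyPrimeResonance

open Summit.RiemannHypothesis.RiemannHypothesis.Theses.RuelleBand
open Literature.NumberTheory.LFunctions
open Summit.RiemannHypothesis.RiemannHypothesis.Theorems (ruelleBand_ladderGlue_proof)
open Summit.RiemannHypothesis.RiemannHypothesis.Theorems.NribWeakRecurrenceToExact
  (exists_zero_right_half zetaWeakRecurrence_of_exactFirstBand)

/-! ### The three stubs -/

/-- **Stub A — DICTIONARY (prime side → zero side): an early large deviation of the trend-free prime wave forces a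
zero far to the right.**  For a smooth window `W` supported in `[-1,1]`, `1/2 < β < 1`, `0 < 2ε < β − 1/2`,
`c, κ > 0` there is `u₀` such that for `u ≥ u₀` and any `T` with `log T ≤ κ·e^{εu}`, a deviation
`c·e^{(β−1/2)u} ≤ |D_W(u,T)|` implies a zero `ρ` of `ζ` with `β − 2ε ≤ Re ρ < 1` and `|Im ρ − T| ≤ e^u`.
(Explicit formula for the Weil test `g = W(·−u)e^{−iT·}`: `ĝ(0) ≪ e^{−u/2}`, `W_∞(g) ≪ log(|T|+2)`, zeros at
height distance `> e^u` from `T` in total `≪ e^{−u} log(|T|+2)`, zeros within `e^u` in total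
`≪ e^{(σ−1/2)u} log(|T|+e^u+2)` with `σ` their maximal real part; size L.) -/
theorem stub_earlyDeviationForcesZero :
    ∀ (W : ℝ → ℝ), ContDiff ℝ ∞ W → tsupport W ⊆ Set.Icc (-1) 1 →
    ∀ (β ε c κ : ℝ), 1 / 2 < β → β < 1 → 0 < ε → 2 * ε < β - 1 / 2 → 0 < c → 0 < κ →
    ∃ u₀ : ℝ, ∀ u T : ℝ, u₀ ≤ u → Real.log T ≤ κ * Real.exp (ε * u) →
      c * Real.exp ((β - 1 / 2) * u) ≤
        ‖weilPrimeTerm (fun t : ℝ => (W (t - u) : ℂ) * Complex.exp (-(T * t * Complex.I))) -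
          weilMellin (fun t : ℝ => (W (t - u) : ℂ) * Complex.exp (-(T * t * Complex.I))) 1‖ →
      ∃ ρ : ℂ, riemannZeta ρ = 0 ∧ β - 2 * ε ≤ ρ.re ∧ ρ.re < 1 ∧ |ρ.im - T| ≤ Real.exp u := by
  sorry

/-- **Stub B — ANOMALY (zero side → prime side): a zero of globally maximal real part is a permanent resonance
of the trend-free prime wave.**  If `ξ` is a zero with `1/2 < Re ξ < 1` and no zero of the open strip lies to
the right of `Re ξ`, then for some `c > 0` the deviation `c·e^{(Re ξ−1/2)u} ≤ |D_W(u, Im ξ)|` holds for an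
unbounded set of scales `u`.  (Explicit formula; `e^{−(Re ξ−1/2)u}·(zero side)` is `Σ_ρ b_ρ e^{(Re ρ−Re ξ)u}
e^{i(Im ρ−Im ξ)u}` with `Σ|b_ρ| < ∞` and `b_ξ = m(ξ)·∫W(y)e^{(Re ξ−1/2)y}dy ≠ 0`; its Cesàro mean over
`u ∈ [0,X]` tends to `b_ξ`, so `limsup ≥ |b_ξ|`; size L.) -/
theorem stub_topZeroForcesDeviation :
    ∀ (W : ℝ → ℝ), ContDiff ℝ ∞ W → (∀ t : ℝ, 0 ≤ W t) → tsupport W ⊆ Set.Icc (-1) 1 → W 0 = 1 →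
    ∀ ξ : ℂ, riemannZeta ξ = 0 → 1 / 2 < ξ.re → ξ.re < 1 →
      (∀ ρ : ℂ, riemannZeta ρ = 0 → 0 < ρ.re → ρ.re < 1 → ρ.re ≤ ξ.re) →
      ∃ c : ℝ, 0 < c ∧ ∀ U : ℝ, ∃ u : ℝ, U ≤ u ∧
        c * Real.exp ((ξ.re - 1 / 2) * u) ≤
          ‖weilPrimeTerm (fun t : ℝ => (W (t - u) : ℂ) * Complex.exp (-(ξ.im * t * Complex.I))) -
            weilMellin (fun t : ℝ => (W (t - u) : ℂ) * Complex.exp (-(ξ.im * t * Complex.I))) 1‖ := by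
  sorry

/-- **Stub C — EARLY RETURN OF A LARGE DEVIATION (the line's open, arithmetic heart; prime sums only).**
For an admissible window `W`, `1/2 < β < 1`, `ε, c > 0` and a height `γ` at which the trend-free prime wave shows
the deviation `c·e^{(β−1/2)u} ≤ |D_W(u,γ)|` for an unbounded set of scales `u`, there are `κ, c' > 0` such that
for every height `T₀` and scale bound `U` some `u ≥ U` and some EARLY late height `T` (`T₀ ≤ T`, `2e^u ≤ T`,
`log T ≤ κ·e^{εu}`) carry a comparable deviation, up to the loss `e^{−εu}`: `c'·e^{(β−ε−1/2)u} ≤ |D_W(u,T)|`.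
Shrinking-target reading: the Kronecker flow `T ↦ (p^{−iT})_{p ≤ e^{u+1}}` brings the trigonometric polynomial
`Σ_p (log p)p^{−1/2}W(log p − u)·ω_p` back into its large-deviation region at a height `T ≤ exp(κe^{εu})`, far
below the Kac/Bohr heights `log T ≍ e^{(2β−1)u}` / `e^{u}`.  RH-implied (under RH the hypothesis fails:
`|D_W(u,γ)| ≪_W log(|γ|+2)` uniformly in `u`); open exactly in a `¬RH` world; FALSE in every world
`AsymptoticCriticalLine ∧ ¬RH` (composition below) — that is its content. -/
theorem stub_earlyReturnOfDeviation :
    ∀ (W : ℝ → ℝ), ContDiff ℝ ∞ W → (∀ t : ℝ, 0 ≤ W t) → tsupport W ⊆ Set.Icc (-1) 1 → W 0 = 1 →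
    ∀ (β ε c : ℝ), 1 / 2 < β → β < 1 → 0 < ε → 0 < c → ∀ γ : ℝ,
      (∀ U : ℝ, ∃ u : ℝ, U ≤ u ∧
        c * Real.exp ((β - 1 / 2) * u) ≤
          ‖weilPrimeTerm (fun t : ℝ => (W (t - u) : ℂ) * Complex.exp (-(γ * t * Complex.I))) -
            weilMellin (fun t : ℝ => (W (t - u) : ℂ) * Complex.exp (-(γ * t * Complex.I))) 1‖) →
      ∃ κ c' : ℝ, 0 < κ ∧ 0 < c' ∧ ∀ T₀ U : ℝ, ∃ u T : ℝ, U ≤ u ∧ T₀ ≤ T ∧ 2 * Real.exp u ≤ T ∧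
        Real.log T ≤ κ * Real.exp (ε * u) ∧
        c' * Real.exp ((β - ε - 1 / 2) * u) ≤
          ‖weilPrimeTerm (fun t : ℝ => (W (t - u) : ℂ) * Complex.exp (-(T * t * Complex.I))) -
            weilMellin (fun t : ℝ => (W (t - u) : ℂ) * Complex.exp (-(T * t * Complex.I))) 1‖ := by
  sorry

/-! ### The composition -/

/-- **No off-line zero under `AsymptoticCriticalLine`** (the three stubs composed).  Given a zero `ξ₀` with
`1/2 < Re ξ₀ < 1`, put `δ := Re ξ₀ − 1/2`; by ACL the zeros with `|Re s − 1/2| ≥ δ/2` form a finite set `F`;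
a zero `ξ ∈ F` of maximal real part `Θ` is a GLOBAL top zero; let `H` bound `|Im ρ|` on `F`.  Stub B at `ξ`
feeds Stub C (`β = Θ`, `ε = δ/16`), which returns `κ, c'`, then — called with the threshold `u₀` of Stub A at
`(β, ε) = (Θ − ε, ε)` and the height `2H + 2` — a scale `u ≥ u₀` and an early height `T ≥ max(2H+2, 2e^u)`
carrying the deviation `c'e^{(Θ−ε−1/2)u}`; Stub A produces a zero `ρ` with `Re ρ ≥ Θ − 3δ/16 ≥ 1/2 + δ/2`,
so `ρ ∈ F`, but `Im ρ ≥ T − e^u ≥ T/2 ≥ H + 1 > H`: contradiction. -/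
theorem no_offLine_zero_of_acl (hACL : AsymptoticCriticalLine) :
    ∀ ξ₀ : ℂ, riemannZeta ξ₀ = 0 → 1 / 2 < ξ₀.re → ξ₀.re < 1 → False := by
  intro ξ₀ hξ₀ h₁ h₂
  -- the window: a smooth bump, `= 1` on `[-1/2, 1/2]`, supported in `[-1, 1]`
  let b : ContDiffBump (0 : ℝ) := ⟨1 / 2, 1, by norm_num, by norm_num⟩
  have hW₁ : ContDiff ℝ ∞ (b : ℝ → ℝ) := b.contDiff
  have hW₂ : ∀ t : ℝ, 0 ≤ b t := fun t => b.nonneg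
  have hrOut : b.rOut = 1 := rfl
  have hW₃ : tsupport (b : ℝ → ℝ) ⊆ Set.Icc (-1) 1 := by
    rw [b.tsupport_eq, hrOut, Real.closedBall_eq_Icc]
    norm_num
  have hW₄ : b 0 = 1 := b.one_of_mem_closedBall (Metric.mem_closedBall_self b.rIn_pos.le)
  -- the finite set of zeros right of `1/2 + δ/2` (and their mirror images), by ACL
  set δ : ℝ := ξ₀.re - 1 / 2 with hδ
  have hδpos : 0 < δ := by rw [hδ]; linarith
  set F : Set ℂ := {s : ℂ | riemannZeta s = 0 ∧ 0 < s.re ∧ s.re < 1 ∧ δ / 2 ≤ |s.re - 1 / 2|} with hF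
  have hFfin : F.Finite := hACL (δ / 2) (by positivity)
  have hξ₀F : ξ₀ ∈ F := by
    refine ⟨hξ₀, by linarith, h₂, ?_⟩
    rw [abs_of_nonneg (by linarith)]
    linarith
  -- a zero of maximal real part in `F` is a global top zero
  set S : Set ℝ := Complex.re '' F with hS
  have hSfin : S.Finite := hFfin.image _
  have hSne : S.Nonempty := ⟨ξ₀.re, ξ₀, hξ₀F, rfl⟩
  obtain ⟨ξ, hξF, hξΘ⟩ : sSup S ∈ S := hSne.csSup_mem hSfin
  have hle : ∀ ρ ∈ F, ρ.re ≤ ξ.re := fun ρ hρ => by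
    rw [hξΘ]; exact le_csSup hSfin.bddAbove ⟨ρ, hρ, rfl⟩
  have hglob : ∀ ρ : ℂ, riemannZeta ρ = 0 → 0 < ρ.re → ρ.re < 1 → ρ.re ≤ ξ.re := by
    intro ρ hρ0 hρpos hρ1
    rcases le_or_gt ρ.re ξ₀.re with h | h
    · exact h.trans (hle ξ₀ hξ₀F)
    · refine hle ρ ⟨hρ0, hρpos, hρ1, ?_⟩
      rw [abs_of_nonneg (by linarith)]
      linarith
  obtain ⟨hξ0, hξpos, hξ1, -⟩ := hξF
  have hξre : ξ₀.re ≤ ξ.re := hle ξ₀ hξ₀F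
  have hξhalf : 1 / 2 < ξ.re := by linarith
  -- a height bound for `F`
  set Hs : Set ℝ := (fun ρ : ℂ => |ρ.im|) '' F with hHs
  have hHsfin : Hs.Finite := hFfin.image _
  have hH : ∀ ρ ∈ F, |ρ.im| ≤ sSup Hs := fun ρ hρ => le_csSup hHsfin.bddAbove ⟨ρ, hρ, rfl⟩
  set H : ℝ := sSup Hs with hHdef
  -- the three stubs
  set ε : ℝ := δ / 16 with hε
  have hεpos : 0 < ε := by positivity
  obtain ⟨c, hc, hdev⟩ := stub_topZeroForcesDeviation b hW₁ hW₂ hW₃ hW₄ ξ hξ0 hξhalf hξ1 hglob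
  obtain ⟨κ, c', hκ, hc', hC⟩ :=
    stub_earlyReturnOfDeviation b hW₁ hW₂ hW₃ hW₄ ξ.re ε c hξhalf hξ1 hεpos hc ξ.im hdev
  have hβ₁ : 1 / 2 < ξ.re - ε := by rw [hε]; linarith
  have hβ₂ : ξ.re - ε < 1 := by linarith
  have h2ε : 2 * ε < ξ.re - ε - 1 / 2 := by rw [hε]; linarith
  obtain ⟨u₀, hA⟩ :=
    stub_earlyDeviationForcesZero b hW₁ hW₃ (ξ.re - ε) ε c' κ hβ₁ hβ₂ hεpos h2ε hc' hκ
  obtain ⟨u, T, hu, hT₀, hT2, hlog, hdevT⟩ := hC (2 * H + 2) u₀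
  obtain ⟨ρ, hρ0, hρre, hρ1, hρim⟩ := hA u T hu hlog hdevT
  -- the begotten zero lies in `F` but above the height bound
  have hρpos : 0 < ρ.re := by rw [hε] at hρre; linarith
  have hρF : ρ ∈ F := by
    refine ⟨hρ0, hρpos, hρ1, ?_⟩
    rw [hε] at hρre
    rw [abs_of_nonneg (by linarith)]
    linarith
  have hρH : |ρ.im| ≤ H := hH ρ hρF
  have hexp : 0 < Real.exp u := Real.exp_pos u
  have h1 : ρ.im ≤ H := (le_abs_self _).trans hρH
  have h2 : T - Real.exp u ≤ ρ.im := by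
    have := (abs_le.1 hρim).1
    linarith
  linarith

/-- **`AsymptoticCriticalLine → ExactFirstBand`** (an off-line zero of the open strip gives one in the right half,
tree `exists_zero_right_half`; then `no_offLine_zero_of_acl`). -/
theorem exactFirstBand_of_acl (hACL : AsymptoticCriticalLine) : ExactFirstBand := by
  intro s hs h0 h1
  by_contra h
  push Not at h
  obtain ⟨ξ, hξ0, hξ1, hξ2⟩ := exists_zero_right_half hs h0 h1 h.1
  exact no_offLine_zero_of_acl hACL ξ hξ0 hξ1 hξ2

/-- **COMPOSITION — the crux BY NAME.**  Under the route item `AsymptoticCriticalLine` (crux #4 of route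
RuelleBand, an admissible by-name obligation) the three stubs give `ExactFirstBand`, and the landed calibration
`zetaWeakRecurrence_of_exactFirstBand` (`X → RH → WR`, Bagchi/Voronin) gives `ZetaWeakRecurrence`. -/
theorem ZetaWeakRecurrence_of (hACL : AsymptoticCriticalLine) : ZetaWeakRecurrence :=
  zetaWeakRecurrence_of_exactFirstBand (exactFirstBand_of_acl hACL)

/-- Corollary: the route's open glue rung `AsymptoticToCofinite` (stmt-RiemannHypothesis-14745) BY NAME
(ladder `X → CofiniteCriticalLine`, tree `ruelleBand_ladderGlue_proof`). -/
theorem asymptoticToCofinite_of : AsymptoticToCofinite := fun hACL =>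
  ruelleBand_ladderGlue_proof.1 (exactFirstBand_of_acl hACL)

/-- Corollary: the route's open glue rung `CofiniteToExact` (stmt-RiemannHypothesis-14746) BY NAME
(ladder `CofiniteCriticalLine → AsymptoticCriticalLine`, tree `ruelleBand_ladderGlue_proof`). -/
theorem cofiniteToExact_of : CofiniteToExact := fun hC =>
  exactFirstBand_of_acl (ruelleBand_ladderGlue_proof.2 hC)

end Summit.RiemannHypothesis.RiemannHypothesis.Cruxes.ZetaWeakRecurrence.EarlyPrimeResonance

end
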